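import Mathlib
import Literature.MathematicalPhysics.QuantumFieldTheory.Balaban1983to89.B5Prop11Lattice
import Literature.MathematicalPhysics.QuantumFieldTheory.Balaban1983to89.Beta.VectorPropagatorDict

/-!
# Road «FP», row IR-5′ (c′) — FILE F2: the DISCRETE MINIMUM PRINCIPLE for `Δ + 1` on the fine torus and the
# COMPARISON bound `Re⟨f, (Δ+1)⁻¹f⟩ ≤ Σ_i f_i·v_i` for a supersolution `v`

Cell `pub-balaban`, β sub-cell, binder row D1, road «FP» (owner `b2b-balaban-beta-d1-p3`), lane (U2) IR-5′
(unit `b2b-balaban-beta-d1-formalise-leaf-05`, gen 17).  Second module of the m-UNIFORM SUP LETTER of the perfect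
ff block (`FF-SUP-PLAN.md`; journal INTENT 2026-08-21T09:59Z).  File F1 (`FP/CovarianceLoewnerSandwich`) reduced
the constrained covariance form to `γ₀⁻¹·Re⟨f, (Δ + 1)⁻¹f⟩`, `Δ = B5Prop11Lower.Lap n M` (lattice factor `n`
inside, so `Δ + 1 = n²L₁ + 1` componentwise).  This file supplies the POSITION-SPACE tool that bounds that
free massive form WITHOUT Fourier analysis: `Δ + 1` is a (diagonally dominant) M-matrix, so its inverse is
monotone and is dominated entrywise by any explicit supersolution.

## What this file certifies (kernel, [folklore])
For every `n ≥ 1`, every coarse torus `M`, fine torus `T = Tor (fine n M)`, index `ι = T × Fin d`: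
* §1 `Lap_mulVec_eq`, **`LapOne_mulVec_apply`** (over `VectorPropagatorDict.Lap_mulVec_apply` ∕ `B5Action121.LapS_mulVec`
  BY NAME) — the explicit action
  `((Δ+1)u)(x,κ) = n²·Σ_ν (2u(x,κ) − u(x+e_ν,κ) − u(x−e_ν,κ)) + u(x,κ)` (componentwise in `κ`);
  `re_LapOne_mulVec` — its real part is the same expression in `Re u`.
* §2 **`min_principle`** — for REAL `w`: if `n²·Σ_ν(2w − w(·+e_ν) − w(·−e_ν)) + w ≥ 0` at every point then
  `w ≥ 0` (evaluate at a minimum point: every bracket is `≤ 0` there).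
* §3 `LapOne_mulVec_inv` (`(Δ+1)(Δ+1)⁻¹f = f`), **`re_inv_le_of_supersolution`** — if `v` is real with
  `n²·Σ_ν(2v − …) + v ≥ f` pointwise (`f` real) then `Re ((Δ+1)⁻¹f)_i ≤ v_i` for all `i`;
  `re_inv_nonneg` — `f ≥ 0 ⟹ Re ((Δ+1)⁻¹f) ≥ 0`.
* §4 **`re_form_LapOne_inv_le`** — for `f ≥ 0` real and such a supersolution `v`:
  `Re⟨f, (Δ+1)⁻¹f⟩ ≤ Σ_i f_i·v_i`; and `re_form_LapOne_inv_le_sup` — `≤ (Σ_i f_i)·B` if `v ≤ B` on `supp f`.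

## HONEST SCOPE
Elementary finite-dimensional monotonicity; no B5 statement is used; constants none.  The supersolution itself
(file F3 `FP/TorusSupersolution`) and the block-weight bookkeeping (F4) are NOT here.  0∕4 row-D1 binders; NOT
`hfar`, NOT `hRb`, NOT (ASYMP), NOT D1, NOT BetaPertH, NOT continuum, NOT Clay.
HONEST DEPENDENCY: continuum YM on T⁴ ⇐ BetaPertH ∧ nine spine estimates (0/9 proved); BetaPertH ⇐ (D1) ∧ (D4) ∧
CAP+tail; G-an2-4 gates asym, D1 and NE2/3/4.
-/

noncomputable section

open scoped BigOperators Matrix ComplexConjugate ComplexOrder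

namespace Summit.QuantumFields.BalabanUV.Beta.FP.TorusLaplaceComparison

open Matrix Complex
open Literature.MathematicalPhysics.QuantumFieldTheory.Balaban1983to89
open Literature.MathematicalPhysics.QuantumFieldTheory.Balaban1983to89.B5Prop11Plancherel
open Literature.MathematicalPhysics.QuantumFieldTheory.Balaban1983to89.B5Prop11Lower
open Literature.MathematicalPhysics.QuantumFieldTheory.Balaban1983to89.B5Action121
open Literature.MathematicalPhysics.QuantumFieldTheory.Balaban1983to89.Beta.VectorPropagatorDict

variable {d : ℕ} (n : ℕ) [NeZero n] (M : Fin d → ℕ) [hM : ∀ μ, NeZero (M μ)]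

/-! ## §1 The explicit action of `Δ` and `Δ + 1` -/

/-- the explicit stencil: `(Δu)(x,κ) = n²·Σ_ν (2u(x,κ) − u(x+e_ν,κ) − u(x−e_ν,κ))`. [folklore] -/
theorem Lap_mulVec_eq (u : Tor (fine n M) × Fin d → ℂ) (x : Tor (fine n M)) (κ : Fin d) :
    (Lap n M *ᵥ u) (x, κ)
      = (n : ℂ) ^ 2 * ∑ ν, (2 * u (x, κ) - u (x + unitVec (fine n M) ν, κ) - u (x - unitVec (fine n M) ν, κ)) := by
  rw [Lap_mulVec_apply, LapS_mulVec, Finset.mul_sum]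
  refine Finset.sum_congr rfl fun ν _ => ?_
  rw [Complex.conj_natCast, sq]
  rfl

/-- **`((Δ+1)u)(x,κ) = n²·Σ_ν (2u(x,κ) − u(x+e_ν,κ) − u(x−e_ν,κ)) + u(x,κ)`**. [folklore] -/
theorem LapOne_mulVec_apply (u : Tor (fine n M) × Fin d → ℂ) (x : Tor (fine n M)) (κ : Fin d) :
    ((Lap n M + 1) *ᵥ u) (x, κ)
      = (n : ℂ) ^ 2 * ∑ ν, (2 * u (x, κ) - u (x + unitVec (fine n M) ν, κ) - u (x - unitVec (fine n M) ν, κ))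
        + u (x, κ) := by
  rw [Matrix.add_mulVec, Matrix.one_mulVec, Pi.add_apply, Lap_mulVec_eq]

/-- the real part of `((Δ+1)u)(x,κ)` is the same stencil applied to `Re u`. [folklore] -/
theorem re_LapOne_mulVec (u : Tor (fine n M) × Fin d → ℂ) (x : Tor (fine n M)) (κ : Fin d) :
    (((Lap n M + 1) *ᵥ u) (x, κ)).re
      = (n : ℝ) ^ 2 * ∑ ν, (2 * (u (x, κ)).re - (u (x + unitVec (fine n M) ν, κ)).re
          - (u (x - unitVec (fine n M) ν, κ)).re) + (u (x, κ)).re := by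
  rw [LapOne_mulVec_apply, Complex.add_re, ← Complex.ofReal_natCast, ← Complex.ofReal_pow,
    Complex.re_ofReal_mul, Complex.re_sum]
  congr 2
  refine Finset.sum_congr rfl fun ν _ => ?_
  simp only [Complex.sub_re, Complex.mul_re, Complex.re_ofNat, Complex.im_ofNat, zero_mul, sub_zero]

/-! ## §2 The minimum principle -/

/-- **DISCRETE MINIMUM PRINCIPLE** for `n²L₁ + 1` on the fine torus: a real function whose image under the
stencil-plus-identity is everywhere non-negative is itself non-negative. [folklore] -/
theorem min_principle (w : Tor (fine n M) × Fin d → ℝ)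
    (h : ∀ x κ, 0 ≤ (n : ℝ) ^ 2 * ∑ ν, (2 * w (x, κ) - w (x + unitVec (fine n M) ν, κ)
        - w (x - unitVec (fine n M) ν, κ)) + w (x, κ)) :
    ∀ i, 0 ≤ w i := by
  intro i
  haveI : Nonempty (Tor (fine n M) × Fin d) := ⟨i⟩
  obtain ⟨i₀, hi₀⟩ := Finite.exists_min w
  have hbr : ∀ ν, 2 * w i₀ - w (i₀.1 + unitVec (fine n M) ν, i₀.2) - w (i₀.1 - unitVec (fine n M) ν, i₀.2) ≤ 0 := by
    intro ν
    have h1 := hi₀ (i₀.1 + unitVec (fine n M) ν, i₀.2)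
    have h2 := hi₀ (i₀.1 - unitVec (fine n M) ν, i₀.2)
    linarith
  have hsum : (n : ℝ) ^ 2 * ∑ ν, (2 * w (i₀.1, i₀.2) - w (i₀.1 + unitVec (fine n M) ν, i₀.2)
      - w (i₀.1 - unitVec (fine n M) ν, i₀.2)) ≤ 0 :=
    mul_nonpos_of_nonneg_of_nonpos (by positivity) (Finset.sum_nonpos fun ν _ => hbr ν)
  have h0 : 0 ≤ w i₀ := by
    have := h i₀.1 i₀.2
    simp only [Prod.mk.eta] at this hsum
    linarith
  exact h0.trans (hi₀ i)

/-! ## §3 Comparison with a supersolution -/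

/-- `Δ + 1` is invertible. [folklore] -/
theorem isUnit_LapOne_det : IsUnit (Lap n M + 1).det := by
  have hL : (Lap n M).PosSemidef := by
    rw [Lap]
    exact Matrix.posSemidef_sum _ fun ν _ => Matrix.posSemidef_conjTranspose_mul_self _
  exact (Matrix.isUnit_iff_isUnit_det _).mp (Matrix.PosDef.posSemidef_add hL Matrix.PosDef.one).isUnit

/-- `(Δ+1)·((Δ+1)⁻¹f) = f`. [folklore] -/
theorem LapOne_mulVec_inv (f : Tor (fine n M) × Fin d → ℂ) :
    (Lap n M + 1) *ᵥ ((Lap n M + 1)⁻¹ *ᵥ f) = f := by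
  rw [Matrix.mulVec_mulVec, Matrix.mul_nonsing_inv _ (isUnit_LapOne_det n M), Matrix.one_mulVec]

/-- **COMPARISON**: if `v` is a real supersolution, `n²·Σ_ν(2v − v(·+e_ν) − v(·−e_ν)) + v ≥ f` pointwise
(`f` real), then `Re((Δ+1)⁻¹f) ≤ v` pointwise. [folklore] -/
theorem re_inv_le_of_supersolution (f v : Tor (fine n M) × Fin d → ℝ)
    (hv : ∀ x κ, f (x, κ) ≤ (n : ℝ) ^ 2 * ∑ ν, (2 * v (x, κ) - v (x + unitVec (fine n M) ν, κ)
        - v (x - unitVec (fine n M) ν, κ)) + v (x, κ)) :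
    ∀ i, (((Lap n M + 1)⁻¹ *ᵥ fun j => (f j : ℂ)) i).re ≤ v i := by
  set u : Tor (fine n M) × Fin d → ℂ := (Lap n M + 1)⁻¹ *ᵥ fun j => (f j : ℂ) with hu
  -- the real part of `u` solves the real equation
  have hru : ∀ x κ, (n : ℝ) ^ 2 * ∑ ν, (2 * (u (x, κ)).re - (u (x + unitVec (fine n M) ν, κ)).re
      - (u (x - unitVec (fine n M) ν, κ)).re) + (u (x, κ)).re = f (x, κ) := by
    intro x κ
    rw [← re_LapOne_mulVec, hu, LapOne_mulVec_inv, Complex.ofReal_re]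
  have hw := min_principle n M (fun i => v i - (u i).re) (by
    intro x κ
    have h1 := hv x κ
    have h2 := hru x κ
    have e : ∑ ν, (2 * (v (x, κ) - (u (x, κ)).re)
          - (v (x + unitVec (fine n M) ν, κ) - (u (x + unitVec (fine n M) ν, κ)).re)
          - (v (x - unitVec (fine n M) ν, κ) - (u (x - unitVec (fine n M) ν, κ)).re))
        = ∑ ν, (2 * v (x, κ) - v (x + unitVec (fine n M) ν, κ) - v (x - unitVec (fine n M) ν, κ))
          - ∑ ν, (2 * (u (x, κ)).re - (u (x + unitVec (fine n M) ν, κ)).re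
              - (u (x - unitVec (fine n M) ν, κ)).re) := by
      rw [← Finset.sum_sub_distrib]
      exact Finset.sum_congr rfl fun ν _ => by ring
    rw [e, mul_sub]
    linarith)
  intro i
  have hi : 0 ≤ v i - (u i).re := hw i
  linarith

/-- positivity: `f ≥ 0` real ⟹ `Re((Δ+1)⁻¹f) ≥ 0` pointwise. [folklore] -/
theorem re_inv_nonneg (f : Tor (fine n M) × Fin d → ℝ) (hf : ∀ i, 0 ≤ f i) :
    ∀ i, 0 ≤ (((Lap n M + 1)⁻¹ *ᵥ fun j => (f j : ℂ)) i).re := by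
  set u : Tor (fine n M) × Fin d → ℂ := (Lap n M + 1)⁻¹ *ᵥ fun j => (f j : ℂ) with hu
  refine min_principle n M (fun i => (u i).re) fun x κ => ?_
  rw [← re_LapOne_mulVec, hu, LapOne_mulVec_inv, Complex.ofReal_re]
  exact hf (x, κ)

/-! ## §4 The form bound -/

/-- for real `f`: `Re⟨f, u⟩ = Σ_i f_i · Re u_i`. [folklore] -/
theorem re_dotProduct_ofReal (f : Tor (fine n M) × Fin d → ℝ) (u : Tor (fine n M) × Fin d → ℂ) :
    (star (fun j => (f j : ℂ)) ⬝ᵥ u).re = ∑ i, f i * (u i).re := by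
  simp only [dotProduct, Complex.re_sum, Pi.star_apply, Complex.star_def, Complex.conj_ofReal,
    Complex.re_ofReal_mul]

/-- **THE FORM BOUND**: `f ≥ 0` real, `v` a real supersolution dominating `f` ⟹
`Re⟨f, (Δ+1)⁻¹f⟩ ≤ Σ_i f_i·v_i`. [folklore] -/
theorem re_form_LapOne_inv_le (f v : Tor (fine n M) × Fin d → ℝ) (hf : ∀ i, 0 ≤ f i)
    (hv : ∀ x κ, f (x, κ) ≤ (n : ℝ) ^ 2 * ∑ ν, (2 * v (x, κ) - v (x + unitVec (fine n M) ν, κ)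
        - v (x - unitVec (fine n M) ν, κ)) + v (x, κ)) :
    (star (fun j => (f j : ℂ)) ⬝ᵥ ((Lap n M + 1)⁻¹ *ᵥ fun j => (f j : ℂ))).re ≤ ∑ i, f i * v i := by
  rw [re_dotProduct_ofReal]
  exact Finset.sum_le_sum fun i _ =>
    mul_le_mul_of_nonneg_left (re_inv_le_of_supersolution n M f v hv i) (hf i)

/-- the same with a sup bound on the support: `v ≤ B` wherever `f ≠ 0` ⟹ `Re⟨f,(Δ+1)⁻¹f⟩ ≤ (Σ_i f_i)·B`.
[folklore] -/
theorem re_form_LapOne_inv_le_sup (f v : Tor (fine n M) × Fin d → ℝ) (hf : ∀ i, 0 ≤ f i)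
    (hv : ∀ x κ, f (x, κ) ≤ (n : ℝ) ^ 2 * ∑ ν, (2 * v (x, κ) - v (x + unitVec (fine n M) ν, κ)
        - v (x - unitVec (fine n M) ν, κ)) + v (x, κ))
    {B : ℝ} (hB : ∀ i, f i ≠ 0 → v i ≤ B) :
    (star (fun j => (f j : ℂ)) ⬝ᵥ ((Lap n M + 1)⁻¹ *ᵥ fun j => (f j : ℂ))).re ≤ (∑ i, f i) * B := by
  refine (re_form_LapOne_inv_le n M f v hf hv).trans ?_
  rw [Finset.sum_mul]
  refine Finset.sum_le_sum fun i _ => ?_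
  by_cases h0 : f i = 0
  · rw [h0, zero_mul, zero_mul]
  · exact mul_le_mul_of_nonneg_left (hB i h0) (hf i)

end Summit.QuantumFields.BalabanUV.Beta.FP.TorusLaplaceComparison
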